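import Summits.QuantumFields.BalabanUV.Beta.GAN24.DirichletVertexLocate

/-!
# `BalabanUV.Beta.GAN24.DirichletVertexStarBox` — binder row G-an2-4 / (CONV-C), road P2 PART IV, leaf L14 (the torus transfer), FILE U1:
# THE STAR-BOX IDENTITY `Σ_b Σ_{[−n,n)²} F∘emb_b = 4·Σ_x F(x)` and the sub-box lemma — the bounded-overlap tool for VOLUME-UNIFORM
# constants (unit b2b-balaban-gan24-p2, gen 27, v1)

HONEST FRAMING (cell contract, verbatim): «discharging `BetaPertH` makes Bałaban's UV stability UNCONDITIONAL — a real constructive-QFT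
result; it is NOT the continuum limit and NOT the Clay problem.»  SUPPLIER module under the T⁴-DAG sub-row `T4-U1a.S-NE2-D1-DIRICHLET°`.
The END of leaf L14 (`DirichletVertexEnd.injected_rate_union`, p247276) has the full rate `1/N` with a constant carrying `|V|` (number of
re-entrant vertices) and `|Tor M|` (number of blocks) — LOCATED item L27-1 of memo `gen27/L14-END.md`: every window/vertex bound was closed with
the GLOBAL energy budgets.  The cure is a bounded-overlap count.  THIS FILE proves the one geometric identity behind it: for every `F ≥ 0` on
`Tor (fine n M)` (d = 2), the sum over all block vertices `b` of the sum of `F` over the star box `emb TT b [−n, n)²` is EXACTLY `4·Σ_x F(x)`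
(each site lies in the star of the four corners of its block), the star box sum does not depend on the orientation, every census or vertex
window sum is a sub-sum of it, and a family of vertices with at most one orientation per block vertex (e.g. the re-entrant ones) has total
window sum `≤ 4·Σ_x F(x)`.

## Contents ([folklore] finite sums on the tree's typed torus; 0 sorry)
* §1 `emb_TT_eq_bpt`, `emb_TT_sub_unitVec`, `boxSum`, **`sum_boxSum_TT : Σ_b boxSum F TT b = 4·Σ_x F x`**, `boxSum_orient`.
* §2 `sum_sub_range_le` (shifted sub-box of a nonnegative double range sum), **`window_le_boxSum`**.
* §3 `reentrant_unique`, **`sum_family_boxSum_le`**: `Σ_{v∈V} boxSum F v.1 v.2 ≤ 4·Σ_x F x` when `v ↦ v.2` is injective on `V`.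

ABSOLUTE RULE (cell, verbatim): «No internally-minted statement may enter as a cited fact. Every hypothesis is either kernel-proved in
this package or a verbatim quotation of a PUBLISHED theorem with page reference. The manuscript(s) under audit are NOT citable for
their own disputed steps — they are the thing under adjudication; programme-internal (2001/route/tribunal) claims are never citable.»
Nothing printed is a hypothesis; no estimate of any Bałaban object is made here.  NOT CLAIMED: the volume-uniform END (next files);
NOT NE2, (CONV-C), `BetaPertH`, continuum, Clay.  «not in print; our proof attempt».  HONEST DEPENDENCY: continuum YM on T⁴ ⇐ BetaPertH ∧
nine spine estimates (0/9 proved); BetaPertH ⇐ (D1) ∧ (D4) ∧ CAP+tail; G-an2-4 gates asym, D1 and NE2/3/4.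
-/

noncomputable section

open scoped BigOperators
open Finset

namespace Summit.QuantumFields.BalabanUV.Beta.GAN24.DirichletVertexStarBox

open Literature.MathematicalPhysics.QuantumFieldTheory.Balaban1983to89.B5Prop11Plancherel (Tor fine unitVec)
open Literature.MathematicalPhysics.QuantumFieldTheory.Balaban1983to89.B5Block118 (bpt)
open Literature.MathematicalPhysics.QuantumFieldTheory.Balaban1983to89.B5Blocks16 (bpt_bijective bpt_eq_natCast)
open DirichletVertexChart
open DirichletVertexLocate (TT TT_apply crd_TT emb_TT_add_unitVec emb_crd crd_crd reentrantAt_iff_TT)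

variable (n : ℕ) [NeZero n] (M : Fin 2 → ℕ) [hM : ∀ μ, NeZero (M μ)]

/-! ## §1 The star box and the identity -/

omit [NeZero n] in
/-- the identity-oriented chart on the quadrant block is Bałaban's block parametrisation: `emb TT y o₀ o₁ = bpt y o`. [folklore] -/
theorem emb_TT_eq_bpt (y : Tor M) (o : Fin 2 → Fin n) : emb n M TT y ((o 0 : ℕ) : ℤ) ((o 1 : ℕ) : ℤ) = bpt n M y o := by
  funext ν
  rw [emb_apply, bpt_eq_natCast, crd_TT]
  have hc : cvec (((o 0 : ℕ) : ℕ) : ℤ) (((o 1 : ℕ) : ℕ) : ℤ) ν = ((o ν : ℕ) : ℤ) := by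
    fin_cases ν <;> simp [cvec]
  rw [hc]
  push_cast
  ring

omit [NeZero n] in
/-- vertex shift backward: `emb TT (b − e_μ) i j = emb TT b (i − n·[μ = 0]) (j − n·[μ = 1])`. [folklore] -/
theorem emb_TT_sub_unitVec (μ : Fin 2) (b : Tor M) (i j : ℤ) :
    emb n M TT (b - unitVec M μ) i j = emb n M TT b (i - if μ = 0 then (n : ℤ) else 0) (j - if μ = 1 then (n : ℤ) else 0) := by
  have h := emb_TT_add_unitVec n M μ (b - unitVec M μ) (i - if μ = 0 then (n : ℤ) else 0) (j - if μ = 1 then (n : ℤ) else 0)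
  rw [sub_add_cancel, sub_add_cancel, sub_add_cancel] at h
  exact h.symm

omit [NeZero n] in
/-- `emb TT (b − e₀) i j = emb TT b (i − n) j`. [folklore] -/
theorem emb_TT_sub_e0 (b : Tor M) (i j : ℤ) : emb n M TT (b - unitVec M 0) i j = emb n M TT b (i - n) j := by
  rw [emb_TT_sub_unitVec]; simp

omit [NeZero n] in
/-- `emb TT (b − e₁) i j = emb TT b i (j − n)`. [folklore] -/
theorem emb_TT_sub_e1 (b : Tor M) (i j : ℤ) : emb n M TT (b - unitVec M 1) i j = emb n M TT b i (j - n) := by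
  rw [emb_TT_sub_unitVec]; simp

omit [NeZero n] hM in
/-- congruence of chart sites in the two coordinates. [folklore] -/
theorem F_emb_congr (F : Tor (fine n M) → ℝ) (σ : Fin 2 → Bool) (b : Tor M) {i i' j j' : ℤ} (hi : i = i') (hj : j = j') :
    F (emb n M σ b i j) = F (emb n M σ b i' j') := by rw [hi, hj]

/-- the STAR BOX SUM of `F` at the vertex `b` in orientation `σ`: `Σ_{(i,j) ∈ [−n,n)²} F(emb σ b i j)`. [folklore] -/
def boxSum (F : Tor (fine n M) → ℝ) (σ : Fin 2 → Bool) (b : Tor M) : ℝ :=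
  ∑ t ∈ range (2 * n), ∑ s ∈ range (2 * n), F (emb n M σ b (-(n : ℤ) + s) (-(n : ℤ) + t))

omit [NeZero n] in
/-- a quadrant block of the identity-oriented star box is a block sum: `Σ_{s,t<n} F(emb TT y s t) = Σ_o F(bpt y o)`. [folklore] -/
theorem sum_block_eq (F : Tor (fine n M) → ℝ) (y : Tor M) :
    ∑ t ∈ range n, ∑ s ∈ range n, F (emb n M TT y (s : ℤ) (t : ℤ)) = ∑ o : Fin 2 → Fin n, F (bpt n M y o) := by
  have h1 : ∑ o : Fin 2 → Fin n, F (bpt n M y o) = ∑ st : Fin n × Fin n, F (emb n M TT y ((st.1 : ℕ) : ℤ) ((st.2 : ℕ) : ℤ)) :=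
    Fintype.sum_equiv (piFinTwoEquiv fun _ => Fin n) _ _ (fun o => by
      rw [show (piFinTwoEquiv fun _ => Fin n) o = (o 0, o 1) from rfl]
      simp only
      rw [emb_TT_eq_bpt])
  rw [h1, Fintype.sum_prod_type, Finset.sum_comm, Finset.sum_range]
  refine Fintype.sum_congr _ _ fun s => ?_
  rw [Finset.sum_range]

/-- the sites of all blocks exhaust the torus: `Σ_y Σ_o F(bpt y o) = Σ_x F x`. [folklore] -/
theorem sum_blocks_real (F : Tor (fine n M) → ℝ) : ∑ y : Tor M, ∑ o : Fin 2 → Fin n, F (bpt n M y o) = ∑ x, F x := by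
  rw [← Fintype.sum_prod_type (f := fun yo : Tor M × (Fin 2 → Fin n) => F (bpt n M yo.1 yo.2))]
  exact (bpt_bijective n M).sum_comp F

/-- **THE STAR-BOX IDENTITY**: `Σ_b boxSum F TT b = 4·Σ_x F(x)` — every site lies in the star box of exactly the four corners of its block.
[folklore] -/
theorem sum_boxSum_TT (F : Tor (fine n M) → ℝ) : ∑ b : Tor M, boxSum n M F TT b = 4 * ∑ x, F x := by
  -- split the box into its four quadrant blocks
  have hsplit : ∀ b : Tor M, boxSum n M F TT b
      = ∑ t ∈ range n, ∑ s ∈ range n, F (emb n M TT (b - unitVec M 0 - unitVec M 1) (s : ℤ) (t : ℤ))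
        + ∑ t ∈ range n, ∑ s ∈ range n, F (emb n M TT (b - unitVec M 1) (s : ℤ) (t : ℤ))
        + (∑ t ∈ range n, ∑ s ∈ range n, F (emb n M TT (b - unitVec M 0) (s : ℤ) (t : ℤ))
        + ∑ t ∈ range n, ∑ s ∈ range n, F (emb n M TT b (s : ℤ) (t : ℤ))) := by
    intro b
    unfold boxSum
    rw [two_mul, Finset.sum_range_add]
    simp only [Finset.sum_range_add]
    rw [Finset.sum_add_distrib, Finset.sum_add_distrib]
    refine congrArg₂ (· + ·) (congrArg₂ (· + ·) ?_ ?_) (congrArg₂ (· + ·) ?_ ?_)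
    · refine sum_congr rfl fun t _ => sum_congr rfl fun s _ => ?_
      rw [emb_TT_sub_e1, emb_TT_sub_e0]; exact F_emb_congr n M F TT b (by ring) (by ring)
    · refine sum_congr rfl fun t _ => sum_congr rfl fun s _ => ?_
      rw [emb_TT_sub_e1]; exact F_emb_congr n M F TT b (by push_cast; ring) (by ring)
    · refine sum_congr rfl fun t _ => sum_congr rfl fun s _ => ?_
      rw [emb_TT_sub_e0]; exact F_emb_congr n M F TT b (by ring) (by push_cast; ring)
    · refine sum_congr rfl fun t _ => sum_congr rfl fun s _ => ?_
      exact F_emb_congr n M F TT b (by push_cast; ring) (by push_cast; ring)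
  -- each quadrant family sums to `Σ_x F x` after re-indexing the base vertex
  have hquad : ∀ δ : Tor M, ∑ b : Tor M, ∑ t ∈ range n, ∑ s ∈ range n, F (emb n M TT (b - δ) (s : ℤ) (t : ℤ)) = ∑ x, F x := by
    intro δ
    rw [← sum_blocks_real n M F]
    refine Fintype.sum_equiv (Equiv.subRight δ) _ _ fun b => ?_
    rw [Equiv.subRight_apply, sum_block_eq]
  simp only [hsplit, Finset.sum_add_distrib]
  have h00 := hquad (unitVec M 0 + unitVec M 1)
  have h1 := hquad (unitVec M 1)
  have h0 := hquad (unitVec M 0)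
  have hz := hquad 0
  simp only [sub_zero] at hz
  simp only [sub_add_eq_sub_sub] at h00
  rw [h00, h1, h0, hz]
  ring

omit [NeZero n] hM in
/-- **the star box sum does not depend on the orientation**. [folklore] -/
theorem boxSum_orient (F : Tor (fine n M) → ℝ) (σ : Fin 2 → Bool) (b : Tor M) : boxSum n M F σ b = boxSum n M F TT b := by
  unfold boxSum
  -- `emb σ b i j = emb TT b (crd σ 0 i) (crd σ 1 j)` and `crd` reflects `[−n, n)` onto itself
  have hre : ∀ i j : ℤ, emb n M σ b i j = emb n M TT b (crd σ 0 i) (crd σ 1 j) := by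
    intro i j; rw [← emb_crd n M σ b (crd σ 0 i) (crd σ 1 j), crd_crd, crd_crd]
  simp only [hre]
  -- first axis
  have hax0 : ∀ t : ℕ, ∑ s ∈ range (2 * n), F (emb n M TT b (crd σ 0 (-(n : ℤ) + s)) (crd σ 1 (-(n : ℤ) + t)))
      = ∑ s ∈ range (2 * n), F (emb n M TT b (-(n : ℤ) + s) (crd σ 1 (-(n : ℤ) + t))) := by
    intro t
    unfold crd
    cases σ 0
    · simp only [Bool.false_eq_true, ↓reduceIte]
      rw [← Finset.sum_range_reflect (fun s => F (emb n M TT b (-(n : ℤ) + s) _)) (2 * n)]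
      refine sum_congr rfl fun s hs => ?_
      have hs' := mem_range.mp hs
      congr 2; push_cast [Nat.sub_sub, Nat.cast_sub (show 1 + s ≤ 2 * n by omega)]; ring
    · simp
  simp only [hax0]
  unfold crd
  cases σ 1
  · simp only [Bool.false_eq_true, ↓reduceIte]
    rw [← Finset.sum_range_reflect (fun t => ∑ s ∈ range (2 * n), F (emb n M TT b (-(n : ℤ) + s) (-(n : ℤ) + t))) (2 * n)]
    refine sum_congr rfl fun t ht => ?_
    have ht' := mem_range.mp ht
    refine sum_congr rfl fun s _ => ?_
    congr 2; push_cast [Nat.sub_sub, Nat.cast_sub (show 1 + t ≤ 2 * n by omega)]; ring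
  · simp

/-- hence `Σ_b boxSum F σ_b b = 4·Σ_x F x` for any choice of orientations. [folklore] -/
theorem sum_boxSum (F : Tor (fine n M) → ℝ) (σ : Tor M → (Fin 2 → Bool)) :
    ∑ b : Tor M, boxSum n M F (σ b) b = 4 * ∑ x, F x := by
  rw [← sum_boxSum_TT n M F]
  exact Fintype.sum_congr _ _ fun b => boxSum_orient n M F (σ b) b

/-! ## §2 Windows are sub-boxes -/

omit [NeZero n] hM in
/-- a shifted sub-box of a nonnegative double range sum is at most the whole. [folklore] -/
theorem sum_sub_range_le {A A' B a c : ℕ} (g : ℕ → ℕ → ℝ) (hg : ∀ s t, 0 ≤ g s t) (ha : A + a ≤ B) (hc : A' + c ≤ B) :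
    ∑ t ∈ range A', ∑ s ∈ range A, g (s + a) (t + c) ≤ ∑ t ∈ range B, ∑ s ∈ range B, g s t := by
  have inner : ∀ t, ∑ s ∈ range A, g (s + a) t ≤ ∑ s ∈ range B, g s t := by
    intro t
    rw [show B = a + (B - a) by omega, Finset.sum_range_add]
    calc ∑ s ∈ range A, g (s + a) t ≤ ∑ s ∈ range (B - a), g (a + s) t := by
          simp only [add_comm _ a]
          exact Finset.sum_le_sum_of_subset_of_nonneg (range_subset_range.mpr (by omega)) fun _ _ _ => hg _ _
      _ ≤ _ := le_add_of_nonneg_left (sum_nonneg fun _ _ => hg _ _)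
  rw [show B = c + (B - c) by omega, Finset.sum_range_add]
  calc ∑ t ∈ range A', ∑ s ∈ range A, g (s + a) (t + c)
      ≤ ∑ t ∈ range (B - c), ∑ s ∈ range A, g (s + a) (c + t) := by
        simp only [add_comm _ c]
        exact Finset.sum_le_sum_of_subset_of_nonneg (range_subset_range.mpr (by omega)) fun _ _ _ => sum_nonneg fun _ _ => hg _ _
    _ ≤ ∑ t ∈ range (B - c), ∑ s ∈ range (c + (B - c)), g s (c + t) := sum_le_sum fun t _ => by
        rw [show c + (B - c) = B by omega]; exact inner _
    _ ≤ _ := by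
        rw [show c + (B - c) = B by omega]
        exact le_add_of_nonneg_left (sum_nonneg fun _ _ => sum_nonneg fun _ _ => hg _ _)

omit [NeZero n] hM in
/-- **EVERY WINDOW IS A SUB-BOX**: for `F ≥ 0`, a window `Q_K + (τ₀, τ₁)` inside `[−n, n)²` has
`Σ_{t<2K} Σ_{s<2K} F(emb σ b (−K+s+τ₀) (−K+t+τ₁)) ≤ boxSum F σ b`. [folklore] -/
theorem window_le_boxSum {F : Tor (fine n M) → ℝ} (hF : ∀ x, 0 ≤ F x) (σ : Fin 2 → Bool) (b : Tor M) {K : ℕ} {τ₀ τ₁ : ℤ}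
    (h₀ : -(n : ℤ) ≤ -(K : ℤ) + τ₀) (h₀' : τ₀ + K ≤ n) (h₁ : -(n : ℤ) ≤ -(K : ℤ) + τ₁) (h₁' : τ₁ + K ≤ n) :
    ∑ t ∈ range (2 * K), ∑ s ∈ range (2 * K), F (emb n M σ b (-(K : ℤ) + s + τ₀) (-(K : ℤ) + t + τ₁)) ≤ boxSum n M F σ b := by
  obtain ⟨a, ha⟩ : ∃ a : ℕ, (a : ℤ) = τ₀ + n - K := ⟨(τ₀ + n - K).toNat, by omega⟩
  obtain ⟨c, hc⟩ : ∃ c : ℕ, (c : ℤ) = τ₁ + n - K := ⟨(τ₁ + n - K).toNat, by omega⟩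
  set g : ℕ → ℕ → ℝ := fun s t => F (emb n M σ b (-(n : ℤ) + s) (-(n : ℤ) + t)) with hg
  have e : ∀ s t : ℕ, F (emb n M σ b (-(K : ℤ) + s + τ₀) (-(K : ℤ) + t + τ₁)) = g (s + a) (t + c) := by
    intro s t; simp only [hg]; congr 2 <;> push_cast <;> omega
  simp only [e]
  exact sum_sub_range_le g (fun _ _ => hF _) (by omega) (by omega)

/-! ## §3 Families with one orientation per vertex -/

variable {S : Tor M → Prop}

omit hM in
/-- a block vertex is re-entrant for at most one orientation. [folklore] -/
theorem reentrant_unique {σ σ' : Fin 2 → Bool} {b : Tor M} (h : ReentrantAt M S σ b) (h' : ReentrantAt M S σ' b) : σ = σ' := by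
  by_contra hne
  exact ((reentrantAt_iff_TT M σ b).mp h).1 (((reentrantAt_iff_TT M σ' b).mp h').2 σ hne)

/-- **FAMILY BOUND**: if `v ↦ v.2` is injective on `V` (one orientation per vertex) and `F ≥ 0`, then `Σ_{v∈V} boxSum F v.1 v.2 ≤ 4·Σ_x F x`.
[folklore] -/
theorem sum_family_boxSum_le {F : Tor (fine n M) → ℝ} (hF : ∀ x, 0 ≤ F x) (V : Finset ((Fin 2 → Bool) × Tor M))
    (hinj : ∀ v ∈ V, ∀ v' ∈ V, v.2 = v'.2 → v = v') : ∑ v ∈ V, boxSum n M F v.1 v.2 ≤ 4 * ∑ x, F x := by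
  classical
  have hbox0 : ∀ b, 0 ≤ boxSum n M F TT b := fun b => sum_nonneg fun _ _ => sum_nonneg fun _ _ => hF _
  calc ∑ v ∈ V, boxSum n M F v.1 v.2 = ∑ v ∈ V, boxSum n M F TT v.2 := sum_congr rfl fun v _ => boxSum_orient n M F v.1 v.2
    _ = ∑ b ∈ V.image Prod.snd, boxSum n M F TT b := by
        rw [Finset.sum_image]
        intro v hv v' hv' h
        exact hinj v hv v' hv' h
    _ ≤ ∑ b : Tor M, boxSum n M F TT b := Finset.sum_le_sum_of_subset_of_nonneg (subset_univ _) fun b _ _ => hbox0 b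
    _ = 4 * ∑ x, F x := sum_boxSum_TT n M F

omit hM in
/-- the family of re-entrant vertices has one orientation per vertex. [folklore] -/
theorem reentrant_injOn (V : Finset ((Fin 2 → Bool) × Tor M)) (hV : ∀ v ∈ V, ReentrantAt M S v.1 v.2) :
    ∀ v ∈ V, ∀ v' ∈ V, v.2 = v'.2 → v = v' := by
  intro v hv v' hv' h
  have h1 := hV v hv
  have h2 := hV v' hv'
  rw [h] at h1
  exact Prod.ext (reentrant_unique M h1 h2) h

end Summit.QuantumFields.BalabanUV.Beta.GAN24.DirichletVertexStarBox

end
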